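import Literature.AlgebraicGeometry.Frobenioids.ArchimedeanQuasiIsotropic
import Literature.AlgebraicGeometry.Frobenioids.ArchimedeanStandardType
import Literature.AlgebraicGeometry.Frobenioids.ArchimedeanIsometries
import Literature.AlgebraicGeometry.Frobenioids.Prop55Sub
import Literature.AlgebraicGeometry.Frobenioids.UnitTrivializationModelComparison
import Literature.AlgebraicGeometry.Frobenioids.BirationalizationProp44UnitsProofs
import HarnessLib

/-!
# Frobenioids II, Theorem 3.6 (ii), last clause: "`A` is of standard [but NOT of rationally standard]
# type" — AT THE PARAMETERS of [FrdI] Def. 4.5 (iii) (proof-only; node `FrdII:Thm3.6(ii)` closes)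

Mochizuki, *The geometry of Frobenioids II: poly-Frobenioids*, Kyushu J. Math. **62** (2008)
401–460, §3, Theorem 3.6 (ii), kurims text p. 37 ll. 3–5: "If, moreover, `D` is of FSMFF- and
RC-iso-subanchor type, then `A` is of standard [but not of rationally standard] type"; proof p. 38
ll. 38–40: "On the other hand, since, as is easily verified, `(A^un-tr)^birat` is of unit-trivial type, it
follows that `A` is not of rationally standard type." [cite: MochizukiFrdII2008, Thm 3.6 (ii) p.37]

PROOF-ONLY file (abc-iut cell, layer L1; seat abc-iut-L1-t9 = typer of the schema
`ArchFrd.Thm36ii_standard_notRationallyStandard G F R` (`ArchimedeanStandardType.lean`), sub-DAG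
`plan/L1/SUBDAG-FrdII-Thm36-Prop35.md` row T36-L08; residual #1 of abc-iut-w4-d092's M16 census).  The
schema binds the Def. 4.5 (iii) parameter bundle `R : RSParams` (birationalization, support predicate,
unit-trivialisation and ITS birationalization) as a free variable; the printed claim is its value at THE
constructions, i.e. at `PreFrobenioid.rsParams hA Supp` (`Prop55Sub.lean`: `C^birat :=` THE
birationalization `biratData`, `C^un-tr :=` THE unit-trivialisation with its structure functor
`untrFunctor hA`, `(C^un-tr)^birat :=` THE birationalization of that Frobenioid; `Supp` = the support
predicate of Def. 2.4 (i)(d), here irrelevant and universally quantified), where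
`hA : IsFrobenioid (A.toElem π)` is Example 3.3 (iii) "`A` is a Frobenioid" — DISCHARGED in the tree
(`Ex33iii_isFrobenioid_holds`, under Ex. 3.3 (i)'s standing hypotheses "`D` connected, totally
epimorphic").

* `PreFrobenioid.Birat.untr_isUnitTrivial_of_subsingleton` (generic): for a Frobenioid `C → F_Φ` whose
  divisor monoid has SUBSINGLETON values (e.g. the zero monoid `0_D` — the case of every Frobenioid of
  group-like type such as `A`), every object `X^birat` of `(C^un-tr)^birat` is unit-trivial: by
  abc-iut-L1-d5's `divHom_untr_injective` the divisor map `Div : O^×(X^birat) ↪ Φ^gp(X_D)` is injective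
  on `C^un-tr` ([FrdI] Prop. 4.4 (iii) + Prop. 3.3 (iv)), and `Φ^gp(X_D)` is trivial.
* `ArchFrd.A.untrBirat_isUnitTrivial` — print's "`(A^un-tr)^birat` is of unit-trivial type" AT THE DATA;
  `ArchFrd.A.not_isOfRationallyStandardType_rsParams` — `A` is NOT of rationally standard type w.r.t.
  THE parameters (abc-iut-w4-d092's generic `not_isOfRationallyStandardType_of_forall_isUnitTrivial`:
  Def. 4.5 (iii)(b) wants a Frobenius-compact, hence non-unit-trivial, object of `(A^un-tr)^birat`);
* **`ArchFrd.thm36ii_standard_notRationallyStandard_A`** — the typed clause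
  `Thm36ii_standard_notRationallyStandard (baseRC π) (A.toElem π) (PreFrobenioid.rsParams hA Supp)` for
  EVERY support predicate `Supp`, over every connected, totally epimorphic base `π : D → D₀`; the
  positive half "`A` is of standard type" is abc-iut-w4-d092's `ArchFrd.A.isOfStandardType`
  (`ArchimedeanQuasiIsotropic.lean`, with Prop. 3.5 (ii) discharged).

With this file node `FrdII:Thm3.6(ii)` has no open printed clause (first clauses: `thm36ii_istrBaseTrivial_A`,
`Thm36ii_istrModel_A` / `thm36ii_istrModel_A`, `thm36ii_ampleTypes_A`; standard type: `A.isOfStandardType`).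
No definitions; no statement of the paper is strengthened; nothing here bears on [IUTchIII] Cor. 3.12.
-/

namespace Literature.AlgebraicGeometry.Frobenioids

open CategoryTheory Opposite

universe w v v' u u'

/-! ### Generic: over a divisor monoid with trivial values, `(C^un-tr)^birat` is of unit-trivial type -/

namespace PreFrobenioid

open PreFrobenioidData (ofFunctor)

variable {D : Type u} [Category.{v} D] {Φ : Dᵒᵖ ⥤ CommMonCat.{w}}
  {C : Type u'} [Category.{v'} C] {F : C ⥤ ElemFrobenioid Φ}

/-- The Grothendieck group `M^gp` of a monoid with one element is trivial. [folklore] -/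
private theorem grothendieckGroup_eq_one_of_subsingleton {M : Type w} [CommMonoid M] [Subsingleton M]
    (x : Algebra.GrothendieckGroup M) : x = 1 := by
  induction x using Localization.induction_on with
  | H y =>
    obtain ⟨a, b⟩ := y
    rw [Subsingleton.elim a 1, ← Localization.mk_one]
    congr 1
    exact Subsingleton.elim _ _

/-- **`(C^un-tr)^birat` is of unit-trivial type when `Φ` has trivial values** (e.g. `Φ = 0_D`, every
Frobenioid of group-like type — [FrdII] Thm. 3.6 (ii), proof p. 38 l. 39 for the angular Frobenioid):
for `X ∈ Ob(C^un-tr)`, `Div : O^×(X^birat) → Φ^gp(X_D)` is injective ([FrdI] Prop. 4.4 (iii) with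
Prop. 3.3 (iv), abc-iut-L1-d5's `divHom_untr_injective`) into a trivial group, so `O^×(X^birat) = {1}`.
[cite: MochizukiFrdII2008, Thm 3.6 (ii) p.37] -/
theorem Birat.untr_isUnitTrivial_of_subsingleton (hF : IsFrobenioid F)
    (hΦ : ∀ X : D, Subsingleton (Φ.obj (op X))) (A : (ofFunctor Φ F).Untr) :
    (biratOps (isFrobenioid_untr hF) (hasBiratSquares_untr hF)).IsUnitTrivial
      ((toBirat (untrFunctor hF) (isFrobenioid_untr hF) (hasBiratSquares_untr hF)).obj A) := by
  rw [PreFrobenioidData.IsUnitTrivial, Subgroup.eq_bot_iff_forall]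
  intro u hu
  obtain ⟨x, hx⟩ := exists_toAut_eq (hasBiratSquares_untr hF) ⟨u, hu⟩
  haveI := hΦ (baseObj (untrFunctor hF) A)
  have hx1 : x = 1 := divHom_untr_injective hF A (by
    rw [map_one]
    exact grothendieckGroup_eq_one_of_subsingleton _)
  change BiratUnits.toAut (hasBiratSquares_untr hF) x = u at hx
  rw [← hx, hx1, map_one]

end PreFrobenioid

/-! ### The angular Frobenioid `A` of Example 3.3 (iii) -/

namespace ArchFrd

variable {D : Type u} [Category.{v} D] (π : D ⥤ D0)

/-- **"`(A^un-tr)^birat` is of unit-trivial type"** (FrdII p. 38 l. 39) AT THE DATA: every object of THE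
birationalization of THE unit-trivialisation of the angular Frobenioid `A → F_{0_D}` (a Frobenioid:
`hA`, Ex. 3.3 (iii)) is unit-trivial — `Φ = 0_D`. [cite: MochizukiFrdII2008, Thm 3.6 (ii) p.37] -/
theorem A.untrBirat_isUnitTrivial (hA : PreFrobenioid.IsFrobenioid (A.toElem π))
    (Supp : ∀ {X : D}, (PreFrobenioidData.ofFunctor (zeroMonoid D : Dᵒᵖ ⥤ CommMonCat.{0}) (A.toElem π)).Mon X →
      Primes ((PreFrobenioidData.ofFunctor (zeroMonoid D : Dᵒᵖ ⥤ CommMonCat.{0}) (A.toElem π)).Mon X) → Prop)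
    (X : (PreFrobenioid.rsParams hA Supp).BU.Birat) :
    (PreFrobenioid.rsParams hA Supp).BU.ops.IsUnitTrivial X := by
  obtain ⟨X, rfl⟩ := (PreFrobenioid.rsParams hA Supp).BU.obj_surjective X
  exact PreFrobenioid.Birat.untr_isUnitTrivial_of_subsingleton hA
    (fun _ => inferInstanceAs (Subsingleton PUnit)) X

/-- **Thm. 3.6 (ii): `A` is NOT of rationally standard type** w.r.t. THE parameters of [FrdI] Def. 4.5
(iii) (any support predicate): clause (b) of Def. 4.5 (iii) asks for a Frobenius-compact object of
`(A^un-tr)^birat`, which has a unit of infinite order, while every object there is unit-trivial.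
[cite: MochizukiFrdII2008, Thm 3.6 (ii) p.37] -/
theorem A.not_isOfRationallyStandardType_rsParams (hA : PreFrobenioid.IsFrobenioid (A.toElem π))
    (Supp : ∀ {X : D}, (PreFrobenioidData.ofFunctor (zeroMonoid D : Dᵒᵖ ⥤ CommMonCat.{0}) (A.toElem π)).Mon X →
      Primes ((PreFrobenioidData.ofFunctor (zeroMonoid D : Dᵒᵖ ⥤ CommMonCat.{0}) (A.toElem π)).Mon X) → Prop) :
    ¬ (PreFrobenioidData.ofFunctor (zeroMonoid D : Dᵒᵖ ⥤ CommMonCat.{0}) (A.toElem π)).IsOfRationallyStandardType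
        (PreFrobenioid.rsParams hA Supp) :=
  PreFrobenioidData.not_isOfRationallyStandardType_of_forall_isUnitTrivial _ _
    (A.untrBirat_isUnitTrivial π hA Supp)

/-- **[FrdII] Theorem 3.6 (ii), last clause — PROVED AT THE PARAMETERS**: over every connected, totally
epimorphic base `π : D → D₀` (Ex. 3.3 (i)), "if, moreover, `D` is of FSMFF- and RC-iso-subanchor type,
then `A` is of standard [but not of rationally standard] type" — abc-iut-L1-t9's typed clause
`Thm36ii_standard_notRationallyStandard` evaluated at the angular Frobenioid `A → F_{0_D}` and THE
Def. 4.5 (iii) parameters `PreFrobenioid.rsParams hA Supp` (`hA :=` Ex. 3.3 (iii) "`A` is a Frobenioid",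
discharged: `Ex33iii_isFrobenioid_holds`; `Supp` arbitrary). Standard type: abc-iut-w4-d092's
`A.isOfStandardType`. [cite: MochizukiFrdII2008, Thm 3.6 (ii) p.37] -/
theorem thm36ii_standard_notRationallyStandard_A (hconn : IsGraphConnected D)
    (hTE : IsTotallyEpimorphic D)
    (Supp : ∀ {X : D}, (PreFrobenioidData.ofFunctor (zeroMonoid D : Dᵒᵖ ⥤ CommMonCat.{0}) (A.toElem π)).Mon X →
      Primes ((PreFrobenioidData.ofFunctor (zeroMonoid D : Dᵒᵖ ⥤ CommMonCat.{0}) (A.toElem π)).Mon X) → Prop) :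
    Thm36ii_standard_notRationallyStandard (baseRC π) (A.toElem π)
      (PreFrobenioid.rsParams (Ex33iii_isFrobenioid_holds π hconn hTE) Supp) :=
  fun hD hrc =>
    ⟨A.isOfStandardType π hconn hTE hD hrc,
      A.not_isOfRationallyStandardType_rsParams π (Ex33iii_isFrobenioid_holds π hconn hTE) Supp⟩

end ArchFrd

end Literature.AlgebraicGeometry.Frobenioids
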